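import Summits.BirchSwinnertonDyer.BirchSwinnertonDyer.Theorems.ResidualThetaTransportAtTwoResidualSignedLambdaLowerCMAtTwoStationRRoadEval
import Summits.BirchSwinnertonDyer.BirchSwinnertonDyer.Theorems.ResidualThetaTransportAtTwoPollackPairKUnique
import Summits.BirchSwinnertonDyer.BirchSwinnertonDyer.Theorems.ResidualThetaTransportAtTwoResidualSignedLambdaLowerCMAtTwoNormLambdaSocket
import Summits.BirchSwinnertonDyer.BirchSwinnertonDyer.Theorems.ResidualThetaTransportAtTwoResidualSignedLambdaLowerCMAtTwoSelmerDualFinite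
import Summits.BirchSwinnertonDyer.BirchSwinnertonDyer.Theorems.ResidualThetaTransportAtTwoDefs
import Mathlib.RingTheory.PowerSeries.WeierstrassPreparation
import Summits.BirchSwinnertonDyer.BirchSwinnertonDyer.Theorems.ResidualThetaTransportAtTwoResidualSignedLambdaLowerCMAtTwoRelayDescends
import HarnessLib

/-!
# Station (R) of line `onepair` (crux RSL_g, stmt-BirchSwinnertonDyer-22608) — the EVALUATION ROAD, part B
# (port of the stub-critic lineage's k3-g25 sketch `Cruxes/ResidualThetaCountLowerPureAtTwo/Sketch_sidea_k3_g25.lean`, §3 K-β-ev and §3c the scaled column socket EV-C(u))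

Route `ResidualThetaTransportAtTwo` (RTT), crux `ResidualSignedLambdaLowerCMAtTwo` (stmt-BirchSwinnertonDyer-22608), line `onepair` v3f, station (R)
`stub_kzgValueRelation`. Ported by seat `bsd-wall-tp2-p2x-w3` g18 (helper, `--supports … --as helper`, closes nothing) ON CONSUMPTION (STUB-PLAN S148 (iv));
the (R) port of memo `STATION-R-PORT-w3g18.md` (evidence #54 on 22608) feeds `hERL_of_scaledColumnValues_fixedMultiplier` (`μt ↦ 𝔯̃_e·μ̃`, `u := 2^a·3·q·δ`).
AUTHORSHIP: statements and proofs are the stub-ideation seat k3-g25's, graded PASS-substantive by the stub-critic (STUB-PLAN rev 27.3 row 98); this file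
re-homes them under `…Theorems.ThetaTransport.StationR.Road`. THEOREMS ONLY (no definition, no instance, no notation, no `sorry`). BSD is not proved by
anything here; 22608 / 26074 / 24105 OPEN / HOLD.

WHAT (part B): §3 K-β-ev — the level-free identity `C ν · w · E = μ̃ · L⁻` from PRIMITIVE even-level VALUES only, the column socket EV-C and
the datum socket EV-P (`C_mul_mul_eq_mul_of_primitiveValues`, `C_mul_mul_eq_mul_of_columnValues`, `columnValues_of_primitiveValues`,
`hERL_of_columnValues`); §3c the SCALED socket EV-C(u) with the possibly non-`K`-rational constant `u ∈ 𝒪_{S′}` on the `μ̃` side, the road run over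
`Λ_{𝒪_{S′}}` and one-coefficient descent (`hERL_of_scaledColumnValues`, `hERL_of_scaledColumnValues_fixedMultiplier`: `C ν · E = μ̃ · (L⁻ · v)`, `v ≠ 0`),
and `columnValues_of_primitiveValues_unitColumn` (the Coleman-plus torsor unit joins `w`).

References: [Pollack2003] Lemma 4.7, Thm. 5.1, Prop. 6.9, Thm. 6.17, Prop. 6.18; [Kato2004Asterisque] Thm. 12.5 (1) (p. 221), Thm. 16.6.2 (p. 268);
[Washington1997] §7.1–7.2 (power series on the open unit disc), Prop. 7.2/7.3 (Weierstrass preparation).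
-/

set_option autoImplicit false
-- D-0017: single-problem summit, so `Summit.BirchSwinnertonDyer.BirchSwinnertonDyer.…` repeats a namespace BY DESIGN.
set_option linter.dupNamespace false

noncomputable section

open scoped Classical Polynomial

open Polynomial (X cyclotomic)
open Literature.NumberTheory.EllipticCurves Literature.NumberTheory.EllipticCurves.ModularForms
  CongruenceSubgroup Literature.NumberTheory.Automorphic
  Summit.BirchSwinnertonDyer.BirchSwinnertonDyer.Theorems.PollackPairK
  Summit.BirchSwinnertonDyer.BirchSwinnertonDyer.Theorems

namespace Summit.BirchSwinnertonDyer.BirchSwinnertonDyer.Theorems.ThetaTransport.StationR.Road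

/-! ## §3 K-β-ev: the level-free identity from PRIMITIVE even-level values only

The congruence road (landed `MazurTateValuesRelay.C_mul_mul_eq_mul_of_congruences`) needs `μ̃ θ_{2m} ≡ ν w Q_m (mod ω_{2m})`
for all `m` — i.e. equal values at ALL characters of `Γ_{2m}` (imprimitive ones included: CoreChi recursion + TRIVρ on
the print side). The evaluation road below needs the value identity only at PRIMITIVE characters of even level
`2m ≥ 2m₀` — exactly what child A's (VALρ) speaks about — because the column congruence and the Pollack congruence,
once EVALUATED, turn it into `μ̃(ζ-1)·L⁻(ζ-1) = ν·w(ζ-1)·E(ζ-1)` for a LEVEL-FREE pair, and RIG (§2) concludes. -/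

section RelayEv

variable {p : ℕ} [hp : Fact p.Prime] {M : ℕ} {g : CuspForm (Gamma0 M) 2}
  {ι : coeffField g →+* PadicAlgCl p} {Ω : ℂ}
/-- **EV-P ⟹ EV-C (PROVED): the datum form implies the column form**, by the evaluated column congruence (COL-ev) —
so the value of `ν w P⃗_{2m}(z)` at a `p^{2m}`-torsion point depends on the Honda datum only through the column `E`.
[cite: Kobayashi2003, Thm. 6.2 and (8.23) (p. 18)] [cite: Pollack2003, Prop. 6.18] -/
theorem columnValues_of_primitiveValues
    (E : IwasawaAlgebraO (Set.range ι)) (Q : ℕ → IwasawaAlgebraO (Set.range ι))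
    (μt : IwasawaAlgebraO (Set.range ι)) (ν : padicCoeffIntegers (Set.range ι))
    (w : IwasawaAlgebraO (Set.range ι))
    (hcol : ∀ m : ℕ, (((cyclotomicOmega p (2 * m)).map (Int.castRingHom (padicCoeffIntegers (Set.range ι))) :
        (padicCoeffIntegers (Set.range ι))[X]) : IwasawaAlgebraO (Set.range ι)) ∣
      Q m + ((((-1) ^ m * cyclotomicOmegaMinus p (2 * m)).map
        (Int.castRingHom (padicCoeffIntegers (Set.range ι))) :
        (padicCoeffIntegers (Set.range ι))[X]) : IwasawaAlgebraO (Set.range ι)) * E)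
    (m₀ : ℕ)
    (hEV : ∀ m : ℕ, m₀ ≤ m → ∀ ζ : ℂ_[p], IsPrimitiveRoot ζ (p ^ (2 * m)) →
      (∑' k, ((algebraMap (PadicAlgCl p) ℂ_[p]).comp (padicCoeffIntegers (Set.range ι)).subtype)
          (PowerSeries.coeff k μt) * (ζ - 1) ^ k) *
        ((mazurTateElementK g Ω p (2 * m)).map ι).eval₂ (algebraMap (PadicAlgCl p) ℂ_[p]) (ζ - 1) =
      ∑' k, ((algebraMap (PadicAlgCl p) ℂ_[p]).comp (padicCoeffIntegers (Set.range ι)).subtype)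
          (PowerSeries.coeff k (PowerSeries.C ν * w * Q m)) * (ζ - 1) ^ k)
    (m : ℕ) (hm : m₀ ≤ m) (ζ : ℂ_[p]) (hζ : IsPrimitiveRoot ζ (p ^ (2 * m))) :
    (∑' k, ((algebraMap (PadicAlgCl p) ℂ_[p]).comp (padicCoeffIntegers (Set.range ι)).subtype)
        (PowerSeries.coeff k μt) * (ζ - 1) ^ k) *
      ((mazurTateElementK g Ω p (2 * m)).map ι).eval₂ (algebraMap (PadicAlgCl p) ℂ_[p]) (ζ - 1) =
    -(((-1 : ℤ[X]) ^ m * cyclotomicOmegaMinus p (2 * m)).eval₂ (Int.castRingHom ℂ_[p]) (ζ - 1)) *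
      ∑' k, ((algebraMap (PadicAlgCl p) ℂ_[p]).comp (padicCoeffIntegers (Set.range ι)).subtype)
        (PowerSeries.coeff k (PowerSeries.C ν * w * E)) * (ζ - 1) ^ k := by
  have hpow : ζ ^ p ^ (2 * m) = 1 := hζ.pow_eq_one
  have hz : ‖ζ - 1‖ < 1 := norm_sub_one_lt_one_of_pow_prime_pow_eq_one hpow
  rw [hEV m hm ζ hζ, tsum_mul_eval (Set.range ι) _ _ hz, tsum_coeff_eq_neg_mul_of_omega_dvd_add (Set.range ι) (hcol m) hpow,
    tsum_mul_eval (Set.range ι) (PowerSeries.C ν * w) E hz]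
  ring

end RelayEv

/-! ## §3c (T82 (b)) The SCALED column socket EV-C(u): an explicit constant `u ∈ 𝒪_{S'}` (`𝒪 ≤ 𝒪_{S'}`, e.g. `u = 2^a·q`,
`S' = range ι ∪ {q}`) on the `μ̃` side; the evaluation road run VERBATIM over `Λ_{𝒪_{S'}}`; one-coefficient descent to `𝒪`

Values `∑' k, φ(L_k) (ζ-1)^k` are blind to the coefficient ring, so enlarging `S` changes NOTHING on the hypothesis side of
EV-C / EV-P (`tsum_coeff_map_inclusion`); the identity `C ν · w · E = C u · μ̃ · L⁻` obtained over `S'` by RIG descends to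
`𝒪 = 𝒪_{range ι}` by comparing ONE coefficient of `μ̃ · L⁻ ≠ 0`, and `u ∈ 𝒪` comes out as a COROLLARY (never an input).
This is the evaluation-road twin of the landed `…RelayDescends.relay_descends` (k1-g26, 2026-08-29; not importable here:
unbuilt on the farm snapshot — its §A/§E plumbing is re-proved below over an ARBITRARY witness `hO : 𝒪_S ≤ 𝒪_{S'}`,
inline `PowerSeries.map (Subring.inclusion hO)`, no `def`). -/

section Scaled

variable {p : ℕ} [hp : Fact p.Prime] {S S' : Set (PadicAlgCl p)}

/-- Pushing `L ∈ Λ_{𝒪_S}` into `Λ_{𝒪_{S'}}` along `𝒪_S ≤ 𝒪_{S'}` is invisible in `ℚ̄_p⟦T⟧`. [folklore] -/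
theorem iwasawaOToPowerSeries_map_inclusion (hO : padicCoeffIntegers S ≤ padicCoeffIntegers S')
    (L : IwasawaAlgebraO S) :
    iwasawaOToPowerSeries S' (PowerSeries.map (Subring.inclusion hO) L) = iwasawaOToPowerSeries S L := by
  ext k
  rw [coeff_iwasawaOToPowerSeries, coeff_iwasawaOToPowerSeries, PowerSeries.coeff_map, Subring.coe_inclusion]

/-- **Values do not see the coefficient ring**: the value of `L` pushed to `Λ_{𝒪_{S'}}` is the value of `L`. [folklore] -/
theorem tsum_coeff_map_inclusion (hO : padicCoeffIntegers S ≤ padicCoeffIntegers S') (L : IwasawaAlgebraO S)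
    (z : ℂ_[p]) :
    ∑' k, ((algebraMap (PadicAlgCl p) ℂ_[p]).comp (padicCoeffIntegers S').subtype)
        (PowerSeries.coeff k (PowerSeries.map (Subring.inclusion hO) L)) * z ^ k =
      ∑' k, ((algebraMap (PadicAlgCl p) ℂ_[p]).comp (padicCoeffIntegers S).subtype)
        (PowerSeries.coeff k L) * z ^ k :=
  tsum_congr fun k ↦ by
    rw [PowerSeries.coeff_map, RingHom.comp_apply, RingHom.comp_apply, Subring.subtype_apply,
      Subring.subtype_apply, Subring.coe_inclusion]

/-- **`ω_n`-congruences in `Λ_𝒪 ⊗ ℚ` survive enlarging `𝒪`** (in particular the even Pollack congruences of an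
`𝒪`-Pollack pair hold over every `𝒪_{S'} ≥ 𝒪`). [cite: Sprung2017, Cor. 4.4 (shape)] [cite: Pollack2003, Prop. 6.18] -/
theorem isCongrModOmegaO_map_inclusion (hO : padicCoeffIntegers S ≤ padicCoeffIntegers S') {n : ℕ}
    {θ c : (PadicAlgCl p)[X]} {L : IwasawaAlgebraO S}
    (h : IsCongrModOmegaO S n θ ((c : PowerSeries (PadicAlgCl p)) * iwasawaOToPowerSeries S L)) :
    IsCongrModOmegaO S' n θ
      ((c : PowerSeries (PadicAlgCl p)) * iwasawaOToPowerSeries S' (PowerSeries.map (Subring.inclusion hO) L)) := by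
  obtain ⟨m, q, e⟩ := h
  exact ⟨m, PowerSeries.map (Subring.inclusion hO) q, by
    rw [iwasawaOToPowerSeries_map_inclusion, iwasawaOToPowerSeries_map_inclusion]; exact e⟩

variable (S) in
/-- **K-β-ev, COLUMN form, over a GENERIC coefficient set `S` and a generic left family `θ` (PROVED).** If
`θ_m ≡ (−1)^{m+1} ω⁻_{2m} · L⁻ (mod ω_{2m})` in `Λ_{𝒪_S} ⊗ ℚ` for all `m` (the even half of a Pollack pair, over ANY
`𝒪_S`), and the column-form value identities `μ̃(ζ-1) · θ_m(ζ-1) = −((−1)^m ω⁻_{2m})(ζ-1) · (ν w E)(ζ-1)` hold for all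
`m ≥ m₀` and all primitive `ζ` of order `p^{2m}`, then `C ν · w · E = μ̃ · L⁻` in `Λ_{𝒪_S}` (PP-ev, `ω⁻_{2m}(ζ-1) ≠ 0`, RIG).
The `S = range ι`, `θ_m = θ_{2m}(g)^ι` case is `C_mul_mul_eq_mul_of_columnValues`; the point of the generic form is §3c.
[cite: Pollack2003, Lemma 4.7, Thm. 5.1 and Prop. 6.18] [cite: Kato2004Asterisque, Thm. 12.5 (1) (p. 221)] -/
theorem C_mul_mul_eq_mul_of_columnValues_gen [FiniteDimensional ℚ_[p] (padicCoeffField S)]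
    (θ : ℕ → (PadicAlgCl p)[X]) (Lm : IwasawaAlgebraO S)
    (heven : ∀ m : ℕ, IsCongrModOmegaO S (2 * m) (θ m)
      (((((-1) ^ (2 * m / 2 + 1) * cyclotomicOmegaMinus p (2 * m)).map (Int.castRingHom (PadicAlgCl p)) :
          (PadicAlgCl p)[X]) : PowerSeries (PadicAlgCl p)) * iwasawaOToPowerSeries S Lm))
    (E μt : IwasawaAlgebraO S) (ν : padicCoeffIntegers S) (w : IwasawaAlgebraO S) (m₀ : ℕ)
    (hEVC : ∀ m : ℕ, m₀ ≤ m → ∀ ζ : ℂ_[p], IsPrimitiveRoot ζ (p ^ (2 * m)) →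
      (∑' k, ((algebraMap (PadicAlgCl p) ℂ_[p]).comp (padicCoeffIntegers S).subtype)
          (PowerSeries.coeff k μt) * (ζ - 1) ^ k) * (θ m).eval₂ (algebraMap (PadicAlgCl p) ℂ_[p]) (ζ - 1) =
      -(((-1 : ℤ[X]) ^ m * cyclotomicOmegaMinus p (2 * m)).eval₂ (Int.castRingHom ℂ_[p]) (ζ - 1)) *
        ∑' k, ((algebraMap (PadicAlgCl p) ℂ_[p]).comp (padicCoeffIntegers S).subtype)
          (PowerSeries.coeff k (PowerSeries.C ν * w * E)) * (ζ - 1) ^ k) :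
    PowerSeries.C ν * w * E = μt * Lm := by
  rw [← sub_eq_zero]
  refine eq_zero_of_forall_primitive_tsum_eq_zero S (fun i ↦ 2 * (i + m₀) + 1)
    (fun m ↦ ⟨m, by omega⟩) fun i ζ hζ ↦ ?_
  have h2m : 2 * (i + m₀) + 1 + 1 = 2 * (i + m₀ + 1) := by ring
  rw [h2m] at hζ
  set m : ℕ := i + m₀ + 1 with hm
  have hm₀ : m₀ ≤ m := by omega
  have hpow : ζ ^ p ^ (2 * m) = 1 := hζ.pow_eq_one
  have hz : ‖ζ - 1‖ < 1 := norm_sub_one_lt_one_of_pow_prime_pow_eq_one hpow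
  -- (PP-ev) the even congruence, evaluated
  have hθ := NormLambdaSocket.eval₂_eq_mul_tsum_of_isCongrModOmegaO S (heven m) hpow
  have hc : ((-1 : ℤ[X]) ^ (2 * m / 2 + 1) * cyclotomicOmegaMinus p (2 * m)) =
      -((-1) ^ m * cyclotomicOmegaMinus p (2 * m)) := by
    rw [Nat.mul_div_cancel_left m two_pos, pow_succ]; ring
  rw [Polynomial.eval₂_map (Int.castRingHom (PadicAlgCl p)) (algebraMap (PadicAlgCl p) ℂ_[p]) (ζ - 1),
    RingHom.ext_int ((algebraMap (PadicAlgCl p) ℂ_[p]).comp (Int.castRingHom _)) (Int.castRingHom ℂ_[p]), hc,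
    Polynomial.eval₂_neg] at hθ
  -- `ω⁻_{2m}(ζ - 1) ≠ 0` (Pollack, Lemma 4.7)
  have hs : ((-1 : ℤ[X]) ^ m * cyclotomicOmegaMinus p (2 * m)).eval₂ (Int.castRingHom ℂ_[p]) (ζ - 1) ≠ 0 := by
    rw [Polynomial.eval₂_mul, Polynomial.eval₂_pow, Polynomial.eval₂_neg, Polynomial.eval₂_one,
      RingHom.ext_int (Int.castRingHom ℂ_[p]) (algebraMap ℤ ℂ_[p])]
    exact mul_ne_zero (pow_ne_zero _ (neg_ne_zero.mpr one_ne_zero))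
      (eval₂_cyclotomicOmegaMinus_ne_zero (p := p) ⟨m, two_mul m⟩ hζ)
  -- (EV-C) the column-form value identity
  have hV := hEVC m hm₀ ζ hζ
  rw [hθ] at hV
  rw [tsum_coeff_sub S _ _ hz, tsum_mul_eval S μt Lm hz, sub_eq_zero]
  refine mul_left_cancel₀ hs ?_
  linear_combination hV

/-- **One-coefficient descent `Λ_{𝒪_{S'}} → Λ_{𝒪_S}`.** If `F, G ∈ Λ_{𝒪_S}`, `G ≠ 0`, and `F = C u · G` holds after pushing to
`Λ_{𝒪_{S'}}` (`u ∈ 𝒪_{S'}`), then `u ∈ 𝒪_S` (one coefficient `G_k ≠ 0`: `u = F_k / G_k ∈ ℚ_p(S)`, `‖u‖ ≤ 1`) and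
`F = C u · G` in `Λ_{𝒪_S}`. (= the landed `…RelayDescends.exists_eq_C_mul_of_inclΛ_eq` over an arbitrary `≤`-witness; re-proved
only because that module is unbuilt on the farm snapshot.) [folklore] -/
theorem exists_eq_C_mul_of_map_inclusion_eq (hO : padicCoeffIntegers S ≤ padicCoeffIntegers S')
    {F G : IwasawaAlgebraO S} {u : padicCoeffIntegers S'} (hG : G ≠ 0)
    (e : PowerSeries.map (Subring.inclusion hO) F = PowerSeries.C u * PowerSeries.map (Subring.inclusion hO) G) :
    ∃ u₀ : padicCoeffIntegers S, (u₀ : PadicAlgCl p) = u ∧ F = PowerSeries.C u₀ * G := by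
  obtain ⟨k, hk⟩ : ∃ k, PowerSeries.coeff k G ≠ 0 := by
    by_contra hcon
    exact hG (PowerSeries.ext fun k ↦ by rw [map_zero]; exact not_not.1 fun h' ↦ hcon ⟨k, h'⟩)
  have e' : iwasawaOToPowerSeries S F = PowerSeries.C (u : PadicAlgCl p) * iwasawaOToPowerSeries S G := by
    have e₁ := congr_arg (iwasawaOToPowerSeries S') e
    rwa [map_mul, iwasawaOToPowerSeries_map_inclusion, iwasawaOToPowerSeries_map_inclusion,
      MazurTateValuesRelay.iwasawaOToPowerSeries_C] at e₁
  have ek : ((PowerSeries.coeff k F : padicCoeffIntegers S) : PadicAlgCl p) =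
      (u : PadicAlgCl p) * ((PowerSeries.coeff k G : padicCoeffIntegers S) : PadicAlgCl p) := by
    have e₂ := congr_arg (PowerSeries.coeff k) e'
    rwa [coeff_iwasawaOToPowerSeries, PowerSeries.coeff_C_mul, coeff_iwasawaOToPowerSeries] at e₂
  have hGk : ((PowerSeries.coeff k G : padicCoeffIntegers S) : PadicAlgCl p) ≠ 0 := by
    rw [Ne, ZeroMemClass.coe_eq_zero]
    exact hk
  have hu : (u : PadicAlgCl p) ∈ padicCoeffIntegers S := by
    refine ⟨?_, u.2.2⟩
    have : (u : PadicAlgCl p) = ((PowerSeries.coeff k F : padicCoeffIntegers S) : PadicAlgCl p) *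
        (((PowerSeries.coeff k G : padicCoeffIntegers S) : PadicAlgCl p))⁻¹ := by
      rw [ek, mul_inv_cancel_right₀ hGk]
    rw [this]
    exact mul_mem (PowerSeries.coeff k F).2.1 (inv_mem (PowerSeries.coeff k G).2.1)
  refine ⟨⟨u, hu⟩, rfl, ?_⟩
  apply iwasawaOToPowerSeries_injective S
  rw [e', map_mul, MazurTateValuesRelay.iwasawaOToPowerSeries_C]

variable {M : ℕ} {g : CuspForm (Gamma0 M) 2} {ι : coeffField g →+* PadicAlgCl p} {Ω : ℂ}

/-- **Station (R) from the SCALED column-form values — the T82 (b)-compliant socket EV-C(u) (PROVED modulo EV-C(u)).**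
`(L⁺, L⁻)` an `𝒪`-Pollack pair of `g` (`𝒪 = 𝒪_{range ι}`), `E, μ̃ ∈ Λ_𝒪`, `μ̃ ≠ 0`, `u ∈ 𝒪_{S'}` for some `𝒪_{S'} ≥ 𝒪` with
`[ℚ_p(S') : ℚ_p] < ∞` (e.g. `u = 2^a q`, `S' = range ι ∪ {q}`: landed `finiteDimensional_padicCoeffField_range_union_singleton`,
`exists_natCast_pow_mul_mem_padicCoeffIntegers`). EV-C(u): for some `ν ∈ 𝒪 ∖ 0`, a unit `w ∈ Λ_𝒪ˣ`, a threshold `m₀`,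
`u · μ̃(ζ-1) · θ_{2m}(g)^ι(ζ-1) = −((−1)^m ω⁻_{2m})(ζ-1) · (ν w E)(ζ-1)` for all `m ≥ m₀`, all primitive `ζ` of order `p^{2m}`
— the `K`-rational data `ν, w` on the `E` side, the possibly NON-`K`-rational constant `u` (Kato's `q`, Thm. 12.5 (1):
`z_γ ∈ H¹ ⊗ Q(Λ)` only) explicit on the `μ̃` side. THEN `u ∈ 𝒪` (as `u₀`) and `C ν · E = C u₀ · μ̃ · (L⁻ · u')`, `u'` a unit:
station (R) of the (i)-half with `D := C u₀ · μ̃` BY NAME. Proof: the evaluation road over `S'` (`C_mul_mul_eq_mul_of_columnValues_gen`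
with `μ̃ ↦ C u · μ̃`, Pollack congruences pushed by `isCongrModOmegaO_map_inclusion`, values unchanged by
`tsum_coeff_map_inclusion`) and one-coefficient descent (`exists_eq_C_mul_of_map_inclusion_eq`). BSD / RSL_g / KZ_g NOT proved.
[cite: Kato2004Asterisque, Thm. 12.5 (1) (p. 221), Thm. 16.6.2 (p. 268)] [cite: Pollack2003, Prop. 6.18] -/
theorem hERL_of_scaledColumnValues [FiniteDimensional ℚ_[p] (padicCoeffField S')]
    (hO : padicCoeffIntegers (Set.range ι) ≤ padicCoeffIntegers S')
    {Lp Lm : IwasawaAlgebraO (Set.range ι)} (hL : IsPollackPairK g ι Ω Lp Lm)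
    (E μt : IwasawaAlgebraO (Set.range ι)) (hμ : μt ≠ 0) (u : padicCoeffIntegers S')
    (hEVC : ∃ (ν : padicCoeffIntegers (Set.range ι)) (w : IwasawaAlgebraO (Set.range ι)), ν ≠ 0 ∧ IsUnit w ∧
      ∃ m₀ : ℕ, ∀ m : ℕ, m₀ ≤ m → ∀ ζ : ℂ_[p], IsPrimitiveRoot ζ (p ^ (2 * m)) →
        ((algebraMap (PadicAlgCl p) ℂ_[p]).comp (padicCoeffIntegers S').subtype) u *
          (∑' k, ((algebraMap (PadicAlgCl p) ℂ_[p]).comp (padicCoeffIntegers (Set.range ι)).subtype)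
            (PowerSeries.coeff k μt) * (ζ - 1) ^ k) *
          ((mazurTateElementK g Ω p (2 * m)).map ι).eval₂ (algebraMap (PadicAlgCl p) ℂ_[p]) (ζ - 1) =
        -(((-1 : ℤ[X]) ^ m * cyclotomicOmegaMinus p (2 * m)).eval₂ (Int.castRingHom ℂ_[p]) (ζ - 1)) *
          ∑' k, ((algebraMap (PadicAlgCl p) ℂ_[p]).comp (padicCoeffIntegers (Set.range ι)).subtype)
            (PowerSeries.coeff k (PowerSeries.C ν * w * E)) * (ζ - 1) ^ k) :
    ∃ (u₀ ν : padicCoeffIntegers (Set.range ι)) (u' : IwasawaAlgebraO (Set.range ι)),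
      (u₀ : PadicAlgCl p) = u ∧ ν ≠ 0 ∧ IsUnit u' ∧
        PowerSeries.C ν * E = PowerSeries.C u₀ * μt * (Lm * u') := by
  obtain ⟨ν, w, hν, ⟨wu, rfl⟩, m₀, hV⟩ := hEVC
  have hE : PowerSeries.C (Subring.inclusion hO ν) * PowerSeries.map (Subring.inclusion hO) (wu : IwasawaAlgebraO (Set.range ι)) *
      PowerSeries.map (Subring.inclusion hO) E =
      PowerSeries.map (Subring.inclusion hO) (PowerSeries.C ν * (wu : IwasawaAlgebraO (Set.range ι)) * E) := by
    rw [map_mul, map_mul, PowerSeries.map_C]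
  -- the evaluation road over `S'`, multiplier `C u · μ̃`
  have key := C_mul_mul_eq_mul_of_columnValues_gen S' (fun m ↦ (mazurTateElementK g Ω p (2 * m)).map ι)
    (PowerSeries.map (Subring.inclusion hO) Lm)
    (fun m ↦ isCongrModOmegaO_map_inclusion hO (hL.2.2.2 (2 * m) ⟨m, two_mul m⟩))
    (PowerSeries.map (Subring.inclusion hO) E) (PowerSeries.C u * PowerSeries.map (Subring.inclusion hO) μt)
    (Subring.inclusion hO ν) (PowerSeries.map (Subring.inclusion hO) (wu : IwasawaAlgebraO (Set.range ι))) m₀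
    (fun m hm ζ hζ ↦ by
      have hz : ‖ζ - 1‖ < 1 := norm_sub_one_lt_one_of_pow_prime_pow_eq_one hζ.pow_eq_one
      rw [tsum_mul_eval S' _ _ hz, tsum_coeff_C, tsum_coeff_map_inclusion hO, hE, tsum_coeff_map_inclusion hO]
      exact hV m hm ζ hζ)
  -- `map (C ν · w · E) = C u · map (μ̃ · L⁻)` in `Λ_{𝒪_{S'}}`
  have e : PowerSeries.map (Subring.inclusion hO) (PowerSeries.C ν * (wu : IwasawaAlgebraO (Set.range ι)) * E) =
      PowerSeries.C u * PowerSeries.map (Subring.inclusion hO) (μt * Lm) := by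
    rw [← hE, key, map_mul, mul_assoc]
  -- descend by one coefficient of `μ̃ · L⁻ ≠ 0`
  obtain ⟨u₀, hu₀, hF⟩ := exists_eq_C_mul_of_map_inclusion_eq hO (mul_ne_zero hμ hL.2.1) e
  refine ⟨u₀, ν, ((wu⁻¹ : (IwasawaAlgebraO (Set.range ι))ˣ) : IwasawaAlgebraO (Set.range ι)), hu₀, hν,
    Units.isUnit _, ?_⟩
  have h1 : PowerSeries.C ν * E = PowerSeries.C ν * (wu : IwasawaAlgebraO (Set.range ι)) * E *
      ((wu⁻¹ : (IwasawaAlgebraO (Set.range ι))ˣ) : IwasawaAlgebraO (Set.range ι)) := by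
    rw [mul_right_comm (PowerSeries.C ν) (wu : IwasawaAlgebraO (Set.range ι)) E, Units.mul_inv_cancel_right]
  rw [h1, hF]
  ring

/-- **S142 (3) / T81 form of the scaled socket: `D := μ̃` BY NAME (PROVED modulo EV-C(u)).** Under EV-C(u) with `u ≠ 0`
(`⇐ q ≠ 0`, the first clause of child A's `KatoValuedClass`): `∃ ν v, ν ≠ 0 ∧ v ≠ 0 ∧ C ν · E = μ̃ · (L⁻ · v)` — exactly the
`(ν, u)`-slots of the landed `PriceNode.price_of_parts` (`u ≠ 0`, `D` a `Λ`-slot), with `v = C u₀ · u'`; no «constants are λ-null»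
lemma and no `K`-rationality INPUT is needed. BSD / RSL_g / KZ_g NOT proved. [cite: Kato2004Asterisque, Thm. 12.5 (1) (p. 221)] -/
theorem hERL_of_scaledColumnValues_fixedMultiplier [FiniteDimensional ℚ_[p] (padicCoeffField S')]
    (hO : padicCoeffIntegers (Set.range ι) ≤ padicCoeffIntegers S')
    {Lp Lm : IwasawaAlgebraO (Set.range ι)} (hL : IsPollackPairK g ι Ω Lp Lm)
    (E μt : IwasawaAlgebraO (Set.range ι)) (hμ : μt ≠ 0) (u : padicCoeffIntegers S') (hu : u ≠ 0)
    (hEVC : ∃ (ν : padicCoeffIntegers (Set.range ι)) (w : IwasawaAlgebraO (Set.range ι)), ν ≠ 0 ∧ IsUnit w ∧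
      ∃ m₀ : ℕ, ∀ m : ℕ, m₀ ≤ m → ∀ ζ : ℂ_[p], IsPrimitiveRoot ζ (p ^ (2 * m)) →
        ((algebraMap (PadicAlgCl p) ℂ_[p]).comp (padicCoeffIntegers S').subtype) u *
          (∑' k, ((algebraMap (PadicAlgCl p) ℂ_[p]).comp (padicCoeffIntegers (Set.range ι)).subtype)
            (PowerSeries.coeff k μt) * (ζ - 1) ^ k) *
          ((mazurTateElementK g Ω p (2 * m)).map ι).eval₂ (algebraMap (PadicAlgCl p) ℂ_[p]) (ζ - 1) =
        -(((-1 : ℤ[X]) ^ m * cyclotomicOmegaMinus p (2 * m)).eval₂ (Int.castRingHom ℂ_[p]) (ζ - 1)) *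
          ∑' k, ((algebraMap (PadicAlgCl p) ℂ_[p]).comp (padicCoeffIntegers (Set.range ι)).subtype)
            (PowerSeries.coeff k (PowerSeries.C ν * w * E)) * (ζ - 1) ^ k) :
    ∃ (ν : padicCoeffIntegers (Set.range ι)) (v : IwasawaAlgebraO (Set.range ι)), ν ≠ 0 ∧ v ≠ 0 ∧
      PowerSeries.C ν * E = μt * (Lm * v) := by
  obtain ⟨u₀, ν, u', hu₀, hν, hu', h⟩ := hERL_of_scaledColumnValues hO hL E μt hμ u hEVC
  have hu₀' : u₀ ≠ 0 := by
    rintro rfl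
    apply hu
    have h0 : (u : PadicAlgCl p) = 0 := by rw [← hu₀]; simp
    exact_mod_cast h0
  have hC : (PowerSeries.C u₀ : IwasawaAlgebraO (Set.range ι)) ≠ 0 := by
    intro hC
    apply hu₀'
    have h1 := congr_arg (PowerSeries.coeff 0) hC
    rwa [PowerSeries.coeff_zero_C, map_zero] at h1
  exact ⟨ν, PowerSeries.C u₀ * u', hν, mul_ne_zero hC hu'.ne_zero, by rw [h]; ring⟩

/-- **(β / S143) EV-P against a unit-rescaled column ⟹ EV-C with the unit joining `w` (PROVED).** If the Honda datum's column
is `U · E` for a unit `U` (the Coleman-plus TORSOR: landed `ColemanPlusTorsor.exists_unit_mul_col_of_pin`), the datum-form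
values give the column-form values against `E` itself with `w ↦ w · U` — so EV-C (and EV-C(u)) never sees the torsor. -/
theorem columnValues_of_primitiveValues_unitColumn
    (E U : IwasawaAlgebraO (Set.range ι)) (Q : ℕ → IwasawaAlgebraO (Set.range ι))
    (μt : IwasawaAlgebraO (Set.range ι)) (ν : padicCoeffIntegers (Set.range ι))
    (w : IwasawaAlgebraO (Set.range ι))
    (hcol : ∀ m : ℕ, (((cyclotomicOmega p (2 * m)).map (Int.castRingHom (padicCoeffIntegers (Set.range ι))) :
        (padicCoeffIntegers (Set.range ι))[X]) : IwasawaAlgebraO (Set.range ι)) ∣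
      Q m + ((((-1) ^ m * cyclotomicOmegaMinus p (2 * m)).map
        (Int.castRingHom (padicCoeffIntegers (Set.range ι))) :
        (padicCoeffIntegers (Set.range ι))[X]) : IwasawaAlgebraO (Set.range ι)) * (U * E))
    (m₀ : ℕ)
    (hEV : ∀ m : ℕ, m₀ ≤ m → ∀ ζ : ℂ_[p], IsPrimitiveRoot ζ (p ^ (2 * m)) →
      (∑' k, ((algebraMap (PadicAlgCl p) ℂ_[p]).comp (padicCoeffIntegers (Set.range ι)).subtype)
          (PowerSeries.coeff k μt) * (ζ - 1) ^ k) *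
        ((mazurTateElementK g Ω p (2 * m)).map ι).eval₂ (algebraMap (PadicAlgCl p) ℂ_[p]) (ζ - 1) =
      ∑' k, ((algebraMap (PadicAlgCl p) ℂ_[p]).comp (padicCoeffIntegers (Set.range ι)).subtype)
          (PowerSeries.coeff k (PowerSeries.C ν * w * Q m)) * (ζ - 1) ^ k)
    (m : ℕ) (hm : m₀ ≤ m) (ζ : ℂ_[p]) (hζ : IsPrimitiveRoot ζ (p ^ (2 * m))) :
    (∑' k, ((algebraMap (PadicAlgCl p) ℂ_[p]).comp (padicCoeffIntegers (Set.range ι)).subtype)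
        (PowerSeries.coeff k μt) * (ζ - 1) ^ k) *
      ((mazurTateElementK g Ω p (2 * m)).map ι).eval₂ (algebraMap (PadicAlgCl p) ℂ_[p]) (ζ - 1) =
    -(((-1 : ℤ[X]) ^ m * cyclotomicOmegaMinus p (2 * m)).eval₂ (Int.castRingHom ℂ_[p]) (ζ - 1)) *
      ∑' k, ((algebraMap (PadicAlgCl p) ℂ_[p]).comp (padicCoeffIntegers (Set.range ι)).subtype)
        (PowerSeries.coeff k (PowerSeries.C ν * (w * U) * E)) * (ζ - 1) ^ k := by
  have hr : PowerSeries.C ν * (w * U) * E = PowerSeries.C ν * w * (U * E) := by ring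
  rw [hr]
  exact columnValues_of_primitiveValues (U * E) Q μt ν w hcol m₀ hEV m hm ζ hζ

end Scaled

end Summit.BirchSwinnertonDyer.BirchSwinnertonDyer.Theorems.ThetaTransport.StationR.Road

end
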